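import Summits.QuantumFields.YangMills.Theorems.UnitScaleTiltProp7LinGaugeInvariance
import HarnessLib

/-!
# Route `UnitScaleTilt`, crux K1 child «MinimiserStabilityRegPr» (stmt-QuantumFields-19200), skeleton v10, stub `stub_existenceMinimalOrbit` (EX), route (α) — **THE ASSEMBLY
# OF RESTRICTED TANGENT-CRITICALITY: `Lin_W` IS A REAL LINEAR FUNCTIONAL, IT KILLS EVERY INFINITESIMAL GAUGE DIRECTION (✓`Prop7LinGaugeInvariance`), SO IT VANISHES ON
# `T + (gauge directions)` AS SOON AS IT VANISHES ON `T`** (knit lineage, 2026-08-28; the interface the chart-side transport of (141) and the restricted-gauge decomposition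
# plug into to produce the `hcrit` hypothesis of ✓`Prop7FibreELOfTangentCriticalSU2`).

Cell `ym3-torus`, width seat `ym-ust-19200-w2` (gen 4; EX knit lineage).  THEOREMS ONLY (0 `def`, 0 `sorry`).  `--supports stmt-QuantumFields-19200 --as helper`,
count-neutral.  YM₃ on T³ is a ladder rung (R3), not the Clay problem; nothing here claims the stub, the crux, d = 4 or the mass gap.

THE PRINT.  [Balaban1985Variational] p. 282 (26)–(27) (the first variation `⟨A, J⟩` — the tree's letter `Lin_W(ξ)`, ✓`Prop8ActionFirstVariation` ∕
✓`Prop7Growth142T3ChartELStat.hasDerivAt_wilsonAction4_of_hasDerivAt_mulStar`), p. 278 (3)–(5) (gauge invariance), p. 290 (82)–(83) and p. 299 (141) (criticality on the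
tangent space `QδA′ = 0, R D^*δA′ = 0` — real `𝔤`-valued fields); [Balaban1985Averaging] Prop. 4 p. 31 (the restricted-gauge decomposition).  At the chart point `U′` the
transport of (141) through the (47)-chart supplies a set `T` of bond fields on which `Lin_{U′}` vanishes, and the decomposition writes every `𝔰𝔲(2)`-valued
`ξ ∈ ker QSym(U′)` as `τ + (iN(b₋) − U′(b)·iN(b₊)·U′(b)^*)_b` with `τ ∈ T`, `N` Hermitian traceless.  ✓`Prop7LinGaugeInvariance.lin_gaugeDir_eq_zero` (fleet seat p1, gen 10)
already proves that `Lin` kills every infinitesimal gauge direction, for site fields of any kind; this file adds real-linearity and the assembly.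

WHAT IS PROVED (sorry-free, no definition; ns `…Theorems.Prop7TangentCriticalSplit`; any lattice `T^{(j)}` of the tree, `SU(2)`).
§1 ★ `lin_add`, ★ `lin_smul`, ★ `exists_clm_eq_lin` — `Lin_W` is a real continuous linear functional of the bond field (per-plaquette algebra as in
   ✓`Prop8ActionFirstVariation.linPlaq_sub_smul`; finite-dimensional carrier).
§2 ★★ `tangentCritical_su2_of_split` — RESTRICTED TANGENT-CRITICALITY («`Lin_W(ξ) = 0` for every `𝔰𝔲(2)`-valued `ξ` with `Ker ξ`», the `hcrit` hypothesis of
   ✓`Prop7FibreELOfTangentCriticalSU2.fibreEL_of_tangentCritical_su2(_QSym)` with `Ker ξ := (QSym(U′) ξ = 0)`) from (a) a set `T` on which `Lin_W` vanishes and (b) the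
   decomposition `ξ = τ + (gauge direction of a Hermitian-traceless N)`, `τ ∈ T` (§1 + ✓`Prop7LinGaugeInvariance.lin_gaugeDir_eq_zero` BY NAME).
HONEST SCOPE: linear algebra over landed theorems; inputs (a) and (b) at the chart point are HYPOTHESES of §2 (print's (141) transported, and the Hilbert-space decomposition
`ker Q = (ker Q ∩ ker R_S D^*) ⊕ D(N_S)`); nothing of print is asserted.

References: T. Bałaban, CMP 102 (1985) 277–309 [Balaban1985Variational] ((3)–(5) p.278, (26)–(27) p.282, (82)–(83) p.290, (141) p.299); CMP 98 (1985) 17–51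
[Balaban1985Averaging] (Prop. 4 p.31); CMP 99 (1985) 389–434 [Balaban1985BackgroundPropagators] ((3.9)–(3.11) p.392).
-/

set_option autoImplicit false

noncomputable section

open scoped BigOperators Matrix.Norms.L2Operator Matrix Topology
open Filter

namespace Summit.QuantumFields.YangMills.Theorems.Prop7TangentCriticalSplit

open Literature.MathematicalPhysics.QuantumFieldTheory.Balaban1983to89

/-! ## §1 `Lin_W` is a real continuous linear functional -/

section Bricks

variable {P : Params} {j : ℕ}

/-- ★ `Lin_W` is additive in the bond field. [cite: Balaban1985Variational, (26)-(27) p.282] -/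
theorem lin_add (W : GaugeField P j (Matrix.specialUnitaryGroup (Fin 2) ℂ)) (ξ η : PBond P j → Matrix (Fin 2) (Fin 2) ℂ) :
    ∑ p : Plaq P j, (1 / 2) * ((((((GaugeField.plaqHol W p : Matrix.specialUnitaryGroup (Fin 2) ℂ) : Matrix (Fin 2) (Fin 2) ℂ)) - 1)ᴴ
          * (((ξ + η) ⟨p.src, p.μ⟩
              + (W ⟨p.src, p.μ⟩ : Matrix (Fin 2) (Fin 2) ℂ) * (ξ + η) ⟨p.src.shift p.μ, p.ν⟩ * star (W ⟨p.src, p.μ⟩ : Matrix (Fin 2) (Fin 2) ℂ)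
              - ((W ⟨p.src, p.μ⟩ * W ⟨p.src.shift p.μ, p.ν⟩ * (W ⟨p.src.shift p.ν, p.μ⟩)⁻¹ : Matrix.specialUnitaryGroup (Fin 2) ℂ) : Matrix (Fin 2) (Fin 2) ℂ)
                  * (ξ + η) ⟨p.src.shift p.ν, p.μ⟩
                  * star ((W ⟨p.src, p.μ⟩ * W ⟨p.src.shift p.μ, p.ν⟩ * (W ⟨p.src.shift p.ν, p.μ⟩)⁻¹ : Matrix.specialUnitaryGroup (Fin 2) ℂ) : Matrix (Fin 2) (Fin 2) ℂ)
              - ((GaugeField.plaqHol W p : Matrix.specialUnitaryGroup (Fin 2) ℂ) : Matrix (Fin 2) (Fin 2) ℂ) * (ξ + η) ⟨p.src, p.ν⟩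
                  * star ((GaugeField.plaqHol W p : Matrix.specialUnitaryGroup (Fin 2) ℂ) : Matrix (Fin 2) (Fin 2) ℂ))
            * ((GaugeField.plaqHol W p : Matrix.specialUnitaryGroup (Fin 2) ℂ) : Matrix (Fin 2) (Fin 2) ℂ))).trace).re
      = (∑ p : Plaq P j, (1 / 2) * ((((((GaugeField.plaqHol W p : Matrix.specialUnitaryGroup (Fin 2) ℂ) : Matrix (Fin 2) (Fin 2) ℂ)) - 1)ᴴ
          * ((ξ ⟨p.src, p.μ⟩
              + (W ⟨p.src, p.μ⟩ : Matrix (Fin 2) (Fin 2) ℂ) * ξ ⟨p.src.shift p.μ, p.ν⟩ * star (W ⟨p.src, p.μ⟩ : Matrix (Fin 2) (Fin 2) ℂ)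
              - ((W ⟨p.src, p.μ⟩ * W ⟨p.src.shift p.μ, p.ν⟩ * (W ⟨p.src.shift p.ν, p.μ⟩)⁻¹ : Matrix.specialUnitaryGroup (Fin 2) ℂ) : Matrix (Fin 2) (Fin 2) ℂ)
                  * ξ ⟨p.src.shift p.ν, p.μ⟩
                  * star ((W ⟨p.src, p.μ⟩ * W ⟨p.src.shift p.μ, p.ν⟩ * (W ⟨p.src.shift p.ν, p.μ⟩)⁻¹ : Matrix.specialUnitaryGroup (Fin 2) ℂ) : Matrix (Fin 2) (Fin 2) ℂ)
              - ((GaugeField.plaqHol W p : Matrix.specialUnitaryGroup (Fin 2) ℂ) : Matrix (Fin 2) (Fin 2) ℂ) * ξ ⟨p.src, p.ν⟩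
                  * star ((GaugeField.plaqHol W p : Matrix.specialUnitaryGroup (Fin 2) ℂ) : Matrix (Fin 2) (Fin 2) ℂ))
            * ((GaugeField.plaqHol W p : Matrix.specialUnitaryGroup (Fin 2) ℂ) : Matrix (Fin 2) (Fin 2) ℂ))).trace).re)
        + (∑ p : Plaq P j, (1 / 2) * ((((((GaugeField.plaqHol W p : Matrix.specialUnitaryGroup (Fin 2) ℂ) : Matrix (Fin 2) (Fin 2) ℂ)) - 1)ᴴ
          * ((η ⟨p.src, p.μ⟩
              + (W ⟨p.src, p.μ⟩ : Matrix (Fin 2) (Fin 2) ℂ) * η ⟨p.src.shift p.μ, p.ν⟩ * star (W ⟨p.src, p.μ⟩ : Matrix (Fin 2) (Fin 2) ℂ)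
              - ((W ⟨p.src, p.μ⟩ * W ⟨p.src.shift p.μ, p.ν⟩ * (W ⟨p.src.shift p.ν, p.μ⟩)⁻¹ : Matrix.specialUnitaryGroup (Fin 2) ℂ) : Matrix (Fin 2) (Fin 2) ℂ)
                  * η ⟨p.src.shift p.ν, p.μ⟩
                  * star ((W ⟨p.src, p.μ⟩ * W ⟨p.src.shift p.μ, p.ν⟩ * (W ⟨p.src.shift p.ν, p.μ⟩)⁻¹ : Matrix.specialUnitaryGroup (Fin 2) ℂ) : Matrix (Fin 2) (Fin 2) ℂ)
              - ((GaugeField.plaqHol W p : Matrix.specialUnitaryGroup (Fin 2) ℂ) : Matrix (Fin 2) (Fin 2) ℂ) * η ⟨p.src, p.ν⟩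
                  * star ((GaugeField.plaqHol W p : Matrix.specialUnitaryGroup (Fin 2) ℂ) : Matrix (Fin 2) (Fin 2) ℂ))
            * ((GaugeField.plaqHol W p : Matrix.specialUnitaryGroup (Fin 2) ℂ) : Matrix (Fin 2) (Fin 2) ℂ))).trace).re) := by
  rw [← Finset.sum_add_distrib]
  refine Finset.sum_congr rfl fun p _ => ?_
  simp only [Pi.add_apply]
  set E : Matrix (Fin 2) (Fin 2) ℂ := (((GaugeField.plaqHol W p : Matrix.specialUnitaryGroup (Fin 2) ℂ) : Matrix (Fin 2) (Fin 2) ℂ)) - 1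
  set P₀ : Matrix (Fin 2) (Fin 2) ℂ := ((GaugeField.plaqHol W p : Matrix.specialUnitaryGroup (Fin 2) ℂ) : Matrix (Fin 2) (Fin 2) ℂ)
  set V₁ : Matrix (Fin 2) (Fin 2) ℂ := (W ⟨p.src, p.μ⟩ : Matrix (Fin 2) (Fin 2) ℂ)
  set Q : Matrix (Fin 2) (Fin 2) ℂ := ((W ⟨p.src, p.μ⟩ * W ⟨p.src.shift p.μ, p.ν⟩ * (W ⟨p.src.shift p.ν, p.μ⟩)⁻¹ : Matrix.specialUnitaryGroup (Fin 2) ℂ) : Matrix (Fin 2) (Fin 2) ℂ)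
  have key : Eᴴ * (((ξ ⟨p.src, p.μ⟩ + η ⟨p.src, p.μ⟩)
              + V₁ * (ξ ⟨p.src.shift p.μ, p.ν⟩ + η ⟨p.src.shift p.μ, p.ν⟩) * star V₁
              - Q * (ξ ⟨p.src.shift p.ν, p.μ⟩ + η ⟨p.src.shift p.ν, p.μ⟩) * star Q
              - P₀ * (ξ ⟨p.src, p.ν⟩ + η ⟨p.src, p.ν⟩) * star P₀) * P₀)
      = Eᴴ * ((ξ ⟨p.src, p.μ⟩ + V₁ * ξ ⟨p.src.shift p.μ, p.ν⟩ * star V₁ - Q * ξ ⟨p.src.shift p.ν, p.μ⟩ * star Q - P₀ * ξ ⟨p.src, p.ν⟩ * star P₀) * P₀)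
        + Eᴴ * ((η ⟨p.src, p.μ⟩ + V₁ * η ⟨p.src.shift p.μ, p.ν⟩ * star V₁ - Q * η ⟨p.src.shift p.ν, p.μ⟩ * star Q - P₀ * η ⟨p.src, p.ν⟩ * star P₀) * P₀) := by
    simp only [Matrix.mul_add, Matrix.add_mul, Matrix.mul_sub, Matrix.sub_mul, Matrix.mul_assoc]
    abel
  rw [key, Matrix.trace_add, Complex.add_re]
  ring

/-- ★ `Lin_W` is real-homogeneous in the bond field. [cite: Balaban1985Variational, (26)-(27) p.282] -/
theorem lin_smul (W : GaugeField P j (Matrix.specialUnitaryGroup (Fin 2) ℂ)) (c : ℝ) (ξ : PBond P j → Matrix (Fin 2) (Fin 2) ℂ) :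
    ∑ p : Plaq P j, (1 / 2) * ((((((GaugeField.plaqHol W p : Matrix.specialUnitaryGroup (Fin 2) ℂ) : Matrix (Fin 2) (Fin 2) ℂ)) - 1)ᴴ
          * (((c • ξ) ⟨p.src, p.μ⟩
              + (W ⟨p.src, p.μ⟩ : Matrix (Fin 2) (Fin 2) ℂ) * (c • ξ) ⟨p.src.shift p.μ, p.ν⟩ * star (W ⟨p.src, p.μ⟩ : Matrix (Fin 2) (Fin 2) ℂ)
              - ((W ⟨p.src, p.μ⟩ * W ⟨p.src.shift p.μ, p.ν⟩ * (W ⟨p.src.shift p.ν, p.μ⟩)⁻¹ : Matrix.specialUnitaryGroup (Fin 2) ℂ) : Matrix (Fin 2) (Fin 2) ℂ)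
                  * (c • ξ) ⟨p.src.shift p.ν, p.μ⟩
                  * star ((W ⟨p.src, p.μ⟩ * W ⟨p.src.shift p.μ, p.ν⟩ * (W ⟨p.src.shift p.ν, p.μ⟩)⁻¹ : Matrix.specialUnitaryGroup (Fin 2) ℂ) : Matrix (Fin 2) (Fin 2) ℂ)
              - ((GaugeField.plaqHol W p : Matrix.specialUnitaryGroup (Fin 2) ℂ) : Matrix (Fin 2) (Fin 2) ℂ) * (c • ξ) ⟨p.src, p.ν⟩
                  * star ((GaugeField.plaqHol W p : Matrix.specialUnitaryGroup (Fin 2) ℂ) : Matrix (Fin 2) (Fin 2) ℂ))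
            * ((GaugeField.plaqHol W p : Matrix.specialUnitaryGroup (Fin 2) ℂ) : Matrix (Fin 2) (Fin 2) ℂ))).trace).re
      = c * (∑ p : Plaq P j, (1 / 2) * ((((((GaugeField.plaqHol W p : Matrix.specialUnitaryGroup (Fin 2) ℂ) : Matrix (Fin 2) (Fin 2) ℂ)) - 1)ᴴ
          * ((ξ ⟨p.src, p.μ⟩
              + (W ⟨p.src, p.μ⟩ : Matrix (Fin 2) (Fin 2) ℂ) * ξ ⟨p.src.shift p.μ, p.ν⟩ * star (W ⟨p.src, p.μ⟩ : Matrix (Fin 2) (Fin 2) ℂ)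
              - ((W ⟨p.src, p.μ⟩ * W ⟨p.src.shift p.μ, p.ν⟩ * (W ⟨p.src.shift p.ν, p.μ⟩)⁻¹ : Matrix.specialUnitaryGroup (Fin 2) ℂ) : Matrix (Fin 2) (Fin 2) ℂ)
                  * ξ ⟨p.src.shift p.ν, p.μ⟩
                  * star ((W ⟨p.src, p.μ⟩ * W ⟨p.src.shift p.μ, p.ν⟩ * (W ⟨p.src.shift p.ν, p.μ⟩)⁻¹ : Matrix.specialUnitaryGroup (Fin 2) ℂ) : Matrix (Fin 2) (Fin 2) ℂ)
              - ((GaugeField.plaqHol W p : Matrix.specialUnitaryGroup (Fin 2) ℂ) : Matrix (Fin 2) (Fin 2) ℂ) * ξ ⟨p.src, p.ν⟩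
                  * star ((GaugeField.plaqHol W p : Matrix.specialUnitaryGroup (Fin 2) ℂ) : Matrix (Fin 2) (Fin 2) ℂ))
            * ((GaugeField.plaqHol W p : Matrix.specialUnitaryGroup (Fin 2) ℂ) : Matrix (Fin 2) (Fin 2) ℂ))).trace).re) := by
  rw [Finset.mul_sum]
  refine Finset.sum_congr rfl fun p _ => ?_
  simp only [Pi.smul_apply]
  set E : Matrix (Fin 2) (Fin 2) ℂ := (((GaugeField.plaqHol W p : Matrix.specialUnitaryGroup (Fin 2) ℂ) : Matrix (Fin 2) (Fin 2) ℂ)) - 1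
  set P₀ : Matrix (Fin 2) (Fin 2) ℂ := ((GaugeField.plaqHol W p : Matrix.specialUnitaryGroup (Fin 2) ℂ) : Matrix (Fin 2) (Fin 2) ℂ)
  set V₁ : Matrix (Fin 2) (Fin 2) ℂ := (W ⟨p.src, p.μ⟩ : Matrix (Fin 2) (Fin 2) ℂ)
  set Q : Matrix (Fin 2) (Fin 2) ℂ := ((W ⟨p.src, p.μ⟩ * W ⟨p.src.shift p.μ, p.ν⟩ * (W ⟨p.src.shift p.ν, p.μ⟩)⁻¹ : Matrix.specialUnitaryGroup (Fin 2) ℂ) : Matrix (Fin 2) (Fin 2) ℂ)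
  have key : Eᴴ * ((c • ξ ⟨p.src, p.μ⟩ + V₁ * (c • ξ ⟨p.src.shift p.μ, p.ν⟩) * star V₁ - Q * (c • ξ ⟨p.src.shift p.ν, p.μ⟩) * star Q
              - P₀ * (c • ξ ⟨p.src, p.ν⟩) * star P₀) * P₀)
      = c • (Eᴴ * ((ξ ⟨p.src, p.μ⟩ + V₁ * ξ ⟨p.src.shift p.μ, p.ν⟩ * star V₁ - Q * ξ ⟨p.src.shift p.ν, p.μ⟩ * star Q - P₀ * ξ ⟨p.src, p.ν⟩ * star P₀) * P₀)) := by
    simp only [Matrix.mul_smul, Matrix.smul_mul, Matrix.mul_add, Matrix.add_mul, Matrix.mul_sub, Matrix.sub_mul, smul_add, smul_sub, Matrix.mul_assoc]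
  rw [key, Matrix.trace_smul, Complex.smul_re, smul_eq_mul]
  ring

/-- ★ **`Lin_W` IS A REAL CONTINUOUS LINEAR FUNCTIONAL** of the bond field (finite-dimensional carrier). [cite: Balaban1985Variational, (26)-(27) p.282] -/
theorem exists_clm_eq_lin (W : GaugeField P j (Matrix.specialUnitaryGroup (Fin 2) ℂ)) :
    ∃ ℓ : (PBond P j → Matrix (Fin 2) (Fin 2) ℂ) →L[ℝ] ℝ, ∀ ξ : PBond P j → Matrix (Fin 2) (Fin 2) ℂ,
      ℓ ξ = ∑ p : Plaq P j, (1 / 2) * ((((((GaugeField.plaqHol W p : Matrix.specialUnitaryGroup (Fin 2) ℂ) : Matrix (Fin 2) (Fin 2) ℂ)) - 1)ᴴ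
          * ((ξ ⟨p.src, p.μ⟩
              + (W ⟨p.src, p.μ⟩ : Matrix (Fin 2) (Fin 2) ℂ) * ξ ⟨p.src.shift p.μ, p.ν⟩ * star (W ⟨p.src, p.μ⟩ : Matrix (Fin 2) (Fin 2) ℂ)
              - ((W ⟨p.src, p.μ⟩ * W ⟨p.src.shift p.μ, p.ν⟩ * (W ⟨p.src.shift p.ν, p.μ⟩)⁻¹ : Matrix.specialUnitaryGroup (Fin 2) ℂ) : Matrix (Fin 2) (Fin 2) ℂ)
                  * ξ ⟨p.src.shift p.ν, p.μ⟩
                  * star ((W ⟨p.src, p.μ⟩ * W ⟨p.src.shift p.μ, p.ν⟩ * (W ⟨p.src.shift p.ν, p.μ⟩)⁻¹ : Matrix.specialUnitaryGroup (Fin 2) ℂ) : Matrix (Fin 2) (Fin 2) ℂ)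
              - ((GaugeField.plaqHol W p : Matrix.specialUnitaryGroup (Fin 2) ℂ) : Matrix (Fin 2) (Fin 2) ℂ) * ξ ⟨p.src, p.ν⟩
                  * star ((GaugeField.plaqHol W p : Matrix.specialUnitaryGroup (Fin 2) ℂ) : Matrix (Fin 2) (Fin 2) ℂ))
            * ((GaugeField.plaqHol W p : Matrix.specialUnitaryGroup (Fin 2) ℂ) : Matrix (Fin 2) (Fin 2) ℂ))).trace).re := by
  let Λ : (PBond P j → Matrix (Fin 2) (Fin 2) ℂ) →ₗ[ℝ] ℝ :=
    { toFun := fun ξ => ∑ p : Plaq P j, (1 / 2) * ((((((GaugeField.plaqHol W p : Matrix.specialUnitaryGroup (Fin 2) ℂ) : Matrix (Fin 2) (Fin 2) ℂ)) - 1)ᴴ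
          * ((ξ ⟨p.src, p.μ⟩
              + (W ⟨p.src, p.μ⟩ : Matrix (Fin 2) (Fin 2) ℂ) * ξ ⟨p.src.shift p.μ, p.ν⟩ * star (W ⟨p.src, p.μ⟩ : Matrix (Fin 2) (Fin 2) ℂ)
              - ((W ⟨p.src, p.μ⟩ * W ⟨p.src.shift p.μ, p.ν⟩ * (W ⟨p.src.shift p.ν, p.μ⟩)⁻¹ : Matrix.specialUnitaryGroup (Fin 2) ℂ) : Matrix (Fin 2) (Fin 2) ℂ)
                  * ξ ⟨p.src.shift p.ν, p.μ⟩
                  * star ((W ⟨p.src, p.μ⟩ * W ⟨p.src.shift p.μ, p.ν⟩ * (W ⟨p.src.shift p.ν, p.μ⟩)⁻¹ : Matrix.specialUnitaryGroup (Fin 2) ℂ) : Matrix (Fin 2) (Fin 2) ℂ)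
              - ((GaugeField.plaqHol W p : Matrix.specialUnitaryGroup (Fin 2) ℂ) : Matrix (Fin 2) (Fin 2) ℂ) * ξ ⟨p.src, p.ν⟩
                  * star ((GaugeField.plaqHol W p : Matrix.specialUnitaryGroup (Fin 2) ℂ) : Matrix (Fin 2) (Fin 2) ℂ))
            * ((GaugeField.plaqHol W p : Matrix.specialUnitaryGroup (Fin 2) ℂ) : Matrix (Fin 2) (Fin 2) ℂ))).trace).re
      map_add' := fun ξ η => lin_add W ξ η
      map_smul' := fun c ξ => by
        rw [RingHom.id_apply, smul_eq_mul]
        exact lin_smul W c ξ }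
  exact ⟨LinearMap.toContinuousLinearMap Λ, fun ξ => rfl⟩

/-! ## §2 The assembly -/

/-- ★★ **RESTRICTED TANGENT-CRITICALITY FROM A `Lin`-NULL SET PLUS THE GAUGE DECOMPOSITION** (the interface of the chart-side transport): if `Lin_W` vanishes on a set `T` of
bond fields (the transported slice-tangent directions, print's (141) through the (47)-chart) and every `𝔰𝔲(2)`-valued `ξ` with `Ker ξ` (e.g. `QSym(W) ξ = 0`) splits as
`ξ = τ + (iN(b₋) − W(b)·iN(b₊)·W(b)^*)_b` with `τ ∈ T` and `N` Hermitian traceless (the restricted-gauge decomposition), then `Lin_W(ξ) = 0` for every such `ξ` — the `hcrit`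
hypothesis of ✓`Prop7FibreELOfTangentCriticalSU2` §1–§2. [cite: Balaban1985Variational, (82)-(83) p.290, (141) p.299; Balaban1985Averaging, Prop. 4 p.31] -/
theorem tangentCritical_su2_of_split (W : GaugeField P j (Matrix.specialUnitaryGroup (Fin 2) ℂ)) (Ker : (PBond P j → Matrix (Fin 2) (Fin 2) ℂ) → Prop) (T : Set (PBond P j → Matrix (Fin 2) (Fin 2) ℂ))
    (hT : ∀ τ ∈ T, ∑ p : Plaq P j, (1 / 2) * ((((((GaugeField.plaqHol W p : Matrix.specialUnitaryGroup (Fin 2) ℂ) : Matrix (Fin 2) (Fin 2) ℂ)) - 1)ᴴ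
          * ((τ ⟨p.src, p.μ⟩
              + (W ⟨p.src, p.μ⟩ : Matrix (Fin 2) (Fin 2) ℂ) * τ ⟨p.src.shift p.μ, p.ν⟩ * star (W ⟨p.src, p.μ⟩ : Matrix (Fin 2) (Fin 2) ℂ)
              - ((W ⟨p.src, p.μ⟩ * W ⟨p.src.shift p.μ, p.ν⟩ * (W ⟨p.src.shift p.ν, p.μ⟩)⁻¹ : Matrix.specialUnitaryGroup (Fin 2) ℂ) : Matrix (Fin 2) (Fin 2) ℂ)
                  * τ ⟨p.src.shift p.ν, p.μ⟩
                  * star ((W ⟨p.src, p.μ⟩ * W ⟨p.src.shift p.μ, p.ν⟩ * (W ⟨p.src.shift p.ν, p.μ⟩)⁻¹ : Matrix.specialUnitaryGroup (Fin 2) ℂ) : Matrix (Fin 2) (Fin 2) ℂ)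
              - ((GaugeField.plaqHol W p : Matrix.specialUnitaryGroup (Fin 2) ℂ) : Matrix (Fin 2) (Fin 2) ℂ) * τ ⟨p.src, p.ν⟩
                  * star ((GaugeField.plaqHol W p : Matrix.specialUnitaryGroup (Fin 2) ℂ) : Matrix (Fin 2) (Fin 2) ℂ))
            * ((GaugeField.plaqHol W p : Matrix.specialUnitaryGroup (Fin 2) ℂ) : Matrix (Fin 2) (Fin 2) ℂ))).trace).re = 0)
    (hsplit : ∀ ξ : PBond P j → Matrix (Fin 2) (Fin 2) ℂ, (∀ b, star (ξ b) = -ξ b ∧ (ξ b).trace = 0) → Ker ξ →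
      ∃ τ ∈ T, ∃ N : Site P j → Matrix (Fin 2) (Fin 2) ℂ, (∀ x, (N x).IsHermitian ∧ Matrix.trace (N x) = 0) ∧
        ∀ b : PBond P j, ξ b = τ b + (Complex.I • N b.src - (W b : Matrix (Fin 2) (Fin 2) ℂ) * (Complex.I • N b.tgt) * star (W b : Matrix (Fin 2) (Fin 2) ℂ))) :
    ∀ ξ : PBond P j → Matrix (Fin 2) (Fin 2) ℂ, (∀ b, star (ξ b) = -ξ b ∧ (ξ b).trace = 0) → Ker ξ →
      ∑ p : Plaq P j, (1 / 2) * ((((((GaugeField.plaqHol W p : Matrix.specialUnitaryGroup (Fin 2) ℂ) : Matrix (Fin 2) (Fin 2) ℂ)) - 1)ᴴ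
          * ((ξ ⟨p.src, p.μ⟩
              + (W ⟨p.src, p.μ⟩ : Matrix (Fin 2) (Fin 2) ℂ) * ξ ⟨p.src.shift p.μ, p.ν⟩ * star (W ⟨p.src, p.μ⟩ : Matrix (Fin 2) (Fin 2) ℂ)
              - ((W ⟨p.src, p.μ⟩ * W ⟨p.src.shift p.μ, p.ν⟩ * (W ⟨p.src.shift p.ν, p.μ⟩)⁻¹ : Matrix.specialUnitaryGroup (Fin 2) ℂ) : Matrix (Fin 2) (Fin 2) ℂ)
                  * ξ ⟨p.src.shift p.ν, p.μ⟩
                  * star ((W ⟨p.src, p.μ⟩ * W ⟨p.src.shift p.μ, p.ν⟩ * (W ⟨p.src.shift p.ν, p.μ⟩)⁻¹ : Matrix.specialUnitaryGroup (Fin 2) ℂ) : Matrix (Fin 2) (Fin 2) ℂ)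
              - ((GaugeField.plaqHol W p : Matrix.specialUnitaryGroup (Fin 2) ℂ) : Matrix (Fin 2) (Fin 2) ℂ) * ξ ⟨p.src, p.ν⟩
                  * star ((GaugeField.plaqHol W p : Matrix.specialUnitaryGroup (Fin 2) ℂ) : Matrix (Fin 2) (Fin 2) ℂ))
            * ((GaugeField.plaqHol W p : Matrix.specialUnitaryGroup (Fin 2) ℂ) : Matrix (Fin 2) (Fin 2) ℂ))).trace).re = 0 := by
  intro ξ hsu hker
  obtain ⟨τ, hτ, N, -, hξ⟩ := hsplit ξ hsu hker
  obtain ⟨ℓ, hℓ⟩ := exists_clm_eq_lin W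
  -- the gauge direction of `iN`, in the letters of ✓`Prop7LinGaugeInvariance` (`b.tgt = b.src.shift b.dir` by definition)
  set g : PBond P j → Matrix (Fin 2) (Fin 2) ℂ := fun b =>
    (fun x => Complex.I • N x) b.src - (W b : Matrix (Fin 2) (Fin 2) ℂ) * (fun x => Complex.I • N x) (b.src.shift b.dir) * star (W b : Matrix (Fin 2) (Fin 2) ℂ) with hg
  have hξ' : ξ = τ + g := funext fun b => by rw [Pi.add_apply, hξ b]; rfl
  have h1 : ℓ τ = 0 := by rw [hℓ]; exact hT τ hτ
  have h2 : ℓ g = 0 := by rw [hℓ]; exact Prop7LinGaugeInvariance.lin_gaugeDir_eq_zero W (fun x => Complex.I • N x)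
  rw [← hℓ, hξ', map_add, h1, h2, add_zero]

end Bricks

end Summit.QuantumFields.YangMills.Theorems.Prop7TangentCriticalSplit

end
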